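import Summits.QuantumFields.YangMills.Theses.MarginalTwistOnset
import HarnessLib

/-!
# Route `MarginalTwistOnset`: the support item `EntropyEventTransfer` (stmt-QuantumFields-9804)

The change-of-measure inequality of the disorder-relevance method (Giacomin–Lacoin–Toninelli 2009,
Derrida–Giacomin–Lacoin–Toninelli 2009, Lacoin 2009), over Mathlib's `InformationTheory.klDiv`: for
probability measures `μ`, `ν` with finite relative entropy `H(ν|μ) = klDiv ν μ` and an event `A` with `ν(A) > 0`,

`μ(A) ≥ ν(A) · exp(−(H(ν|μ) + e⁻¹) / ν(A))`.

Proof (entropy form): with `g = dν/dμ` and Mathlib's `klFun x = x log x + 1 − x ≥ 0`,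
`H(ν|μ) = ∫ klFun(g) dμ = ∫_A + ∫_{Aᶜ}` (`toReal_klDiv_eq_integral_klFun`, `integral_add_compl`); Jensen on `A` and
on `Aᶜ` for the normalised restricted measures (`ConvexOn.map_set_average_le` with `convexOn_klFun`, and
`∫_S g dμ = ν(S)` by `Measure.setIntegral_toReal_rnDeriv`) gives
`ν(S) log(ν(S)/μ(S)) + μ(S) − ν(S) ≤ ∫_S klFun(g) dμ` for `S = A, Aᶜ`; adding, the `μ − ν` terms cancel
(`μ(Ω) = ν(Ω) = 1`), and `(1−ν(A)) log((1−ν(A))/(1−μ(A))) ≥ (1−ν(A)) log(1−ν(A)) ≥ −e⁻¹`, whence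
`ν(A) log(ν(A)/μ(A)) ≤ H + e⁻¹`.  Pure measure theory over Mathlib; nothing here is specific to Yang–Mills and no
summit, leg or crux statement is proved (width seat ym-t4-w17 g0, free hands).
-/

set_option autoImplicit false

namespace Summit.QuantumFields.YangMills.Theorems

open MeasureTheory Set InformationTheory
open scoped ENNReal

/-- `x · log x ≥ −e⁻¹` for `0 ≤ x` (from `t + 1 ≤ exp t` at `t = −1 − log x`). [folklore] -/
theorem neg_exp_neg_one_le_mul_log {x : ℝ} (hx : 0 ≤ x) : -Real.exp (-1) ≤ x * Real.log x := by
  rcases hx.eq_or_lt with rfl | hx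
  · simp [Real.exp_nonneg]
  have h := Real.add_one_le_exp (-1 - Real.log x)
  have hexp : Real.exp (-1 - Real.log x) = Real.exp (-1) * x⁻¹ := by
    rw [Real.exp_sub, Real.exp_log hx, div_eq_mul_inv]
  rw [hexp] at h
  -- `-log x ≤ e⁻¹ / x`, multiply by `x > 0`
  have h' : -Real.log x * x ≤ Real.exp (-1) * x⁻¹ * x :=
    mul_le_mul_of_nonneg_right (by linarith) hx.le
  rw [mul_assoc, inv_mul_cancel₀ hx.ne', mul_one] at h'
  linarith [mul_comm (Real.log x) x]

/-- `x · log (x / c) ≥ −e⁻¹` for `0 ≤ x` and `0 ≤ c ≤ 1` (with Lean's conventions `x / 0 = 0`, `log 0 = 0`).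
[folklore] -/
theorem neg_exp_neg_one_le_mul_log_div {x c : ℝ} (hx : 0 ≤ x) (hc : 0 ≤ c) (hc1 : c ≤ 1) :
    -Real.exp (-1) ≤ x * Real.log (x / c) := by
  rcases hc.eq_or_lt with rfl | hc
  · simp [Real.exp_nonneg]
  rcases hx.eq_or_lt with rfl | hx'
  · simp [Real.exp_nonneg]
  rw [Real.log_div hx'.ne' hc.ne', mul_sub]
  have hlogc : Real.log c ≤ 0 := Real.log_nonpos hc.le hc1
  have h1 : x * Real.log c ≤ 0 := mul_nonpos_of_nonneg_of_nonpos hx hlogc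
  linarith [neg_exp_neg_one_le_mul_log hx]

section Jensen

variable {Ω : Type*} [MeasurableSpace Ω] (μ ν : Measure Ω) [IsFiniteMeasure μ] [IsFiniteMeasure ν]

/-- **Jensen on an event for the Kullback–Leibler integrand**: for finite measures `ν ≪ μ` with
`llr ν μ` `ν`-integrable and an event `S` of positive `μ`-mass,
`μ(S) · klFun(ν(S)/μ(S)) ≤ ∫_S klFun(dν/dμ) dμ`. [folklore] -/
theorem mul_klFun_div_le_setIntegral (hac : ν ≪ μ) (hint : Integrable (llr ν μ) ν)
    {S : Set Ω} (h0 : μ S ≠ 0) :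
    μ.real S * klFun (ν.real S / μ.real S) ≤ ∫ x in S, klFun (ν.rnDeriv μ x).toReal ∂μ := by
  have hgi : Integrable (fun x => klFun (ν.rnDeriv μ x).toReal) μ :=
    (integrable_klFun_rnDeriv_iff hac).mpr hint
  have hfi : Integrable (fun x => (ν.rnDeriv μ x).toReal) μ := Measure.integrable_toReal_rnDeriv
  have hJ := ConvexOn.map_set_average_le (μ := μ) (t := S) (f := fun x => (ν.rnDeriv μ x).toReal)
    convexOn_klFun continuous_klFun.continuousOn isClosed_Ici h0 (measure_ne_top μ S)
    (Filter.Eventually.of_forall fun x => Set.mem_Ici.mpr ENNReal.toReal_nonneg)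
    hfi.integrableOn hgi.integrableOn
  rw [setAverage_eq, setAverage_eq, Measure.setIntegral_toReal_rnDeriv hac S, smul_eq_mul,
    smul_eq_mul] at hJ
  have hpos : 0 < μ.real S :=
    lt_of_le_of_ne measureReal_nonneg (Ne.symm ((measureReal_eq_zero_iff (measure_ne_top μ S)).not.mpr h0))
  calc μ.real S * klFun (ν.real S / μ.real S)
      = μ.real S * klFun ((μ.real S)⁻¹ * ν.real S) := by rw [inv_mul_eq_div]
    _ ≤ μ.real S * ((μ.real S)⁻¹ * ∫ x in S, klFun (ν.rnDeriv μ x).toReal ∂μ) :=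
        mul_le_mul_of_nonneg_left hJ hpos.le
    _ = ∫ x in S, klFun (ν.rnDeriv μ x).toReal ∂μ := by
        rw [← mul_assoc, mul_inv_cancel₀ hpos.ne', one_mul]

/-- The same bound with the `klFun` opened and WITHOUT the positivity assumption on `μ(S)` (when `μ(S) = 0`
absolute continuity gives `ν(S) = 0` and the left-hand side vanishes):
`ν(S) log(ν(S)/μ(S)) + μ(S) − ν(S) ≤ ∫_S klFun(dν/dμ) dμ`. [folklore] -/
theorem mul_log_div_add_sub_le_setIntegral (hac : ν ≪ μ) (hint : Integrable (llr ν μ) ν) (S : Set Ω) :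
    ν.real S * Real.log (ν.real S / μ.real S) + μ.real S - ν.real S
      ≤ ∫ x in S, klFun (ν.rnDeriv μ x).toReal ∂μ := by
  by_cases h0 : μ S = 0
  · have hν0 : ν S = 0 := hac h0
    have h1 : μ.real S = 0 := by simp [measureReal_def, h0]
    have h2 : ν.real S = 0 := by simp [measureReal_def, hν0]
    rw [h1, h2]
    simp only [zero_div, Real.log_zero, mul_zero, zero_add, sub_self]
    exact integral_nonneg fun x => klFun_nonneg ENNReal.toReal_nonneg
  · have h := mul_klFun_div_le_setIntegral μ ν hac hint h0
    have hpos : 0 < μ.real S :=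
      lt_of_le_of_ne measureReal_nonneg
        (Ne.symm ((measureReal_eq_zero_iff (measure_ne_top μ S)).not.mpr h0))
    have heq : μ.real S * klFun (ν.real S / μ.real S)
        = ν.real S * Real.log (ν.real S / μ.real S) + μ.real S - ν.real S := by
      rw [klFun_apply]
      field_simp
    linarith [heq]

end Jensen

/-- **The change-of-measure inequality (event form)** for probability measures: if `klDiv ν μ < ∞` and
`ν(A) > 0` then `ν(A) · exp(−(klDiv ν μ + e⁻¹)/ν(A)) ≤ μ(A)`.
[cite: GiacominToninelliLacoin2009, §1 change-of-measure step] [folklore] -/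
theorem measureReal_mul_exp_neg_klDiv_le {Ω : Type*} [MeasurableSpace Ω] (μ ν : Measure Ω)
    [IsProbabilityMeasure μ] [IsProbabilityMeasure ν] {A : Set Ω} (hA : MeasurableSet A)
    (hKL : klDiv ν μ ≠ ⊤) (hνA : 0 < ν A) :
    ν.real A * Real.exp (-(((klDiv ν μ).toReal + Real.exp (-1)) / ν.real A)) ≤ μ.real A := by
  obtain ⟨hac, hint⟩ := klDiv_ne_top_iff.mp hKL
  have hgi : Integrable (fun x => klFun (ν.rnDeriv μ x).toReal) μ :=
    (integrable_klFun_rnDeriv_iff hac).mpr hint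
  set K : ℝ := (klDiv ν μ).toReal with hKdef
  have hK : K = ∫ x, klFun (ν.rnDeriv μ x).toReal ∂μ := toReal_klDiv_eq_integral_klFun hac
  -- the two Jensen bounds, summed
  have hA1 := mul_log_div_add_sub_le_setIntegral μ ν hac hint A
  have hA2 := mul_log_div_add_sub_le_setIntegral μ ν hac hint Aᶜ
  have hsplit := integral_add_compl hA hgi
  set a : ℝ := ν.real A with hadef
  set b : ℝ := μ.real A with hbdef
  have hac' : ν.real Aᶜ = 1 - a := probReal_compl_eq_one_sub hA
  have hbc' : μ.real Aᶜ = 1 - b := probReal_compl_eq_one_sub hA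
  rw [hac', hbc'] at hA2
  have hsum : a * Real.log (a / b) + (1 - a) * Real.log ((1 - a) / (1 - b)) ≤ K := by
    linarith [hA1, hA2, hsplit, hK]
  -- the complement term is `≥ −e⁻¹`
  have ha1 : a ≤ 1 := by rw [hadef]; exact measureReal_le_one
  have hb1 : b ≤ 1 := by rw [hbdef]; exact measureReal_le_one
  have hb0 : 0 ≤ b := measureReal_nonneg
  have hlow : -Real.exp (-1) ≤ (1 - a) * Real.log ((1 - a) / (1 - b)) :=
    neg_exp_neg_one_le_mul_log_div (by linarith) (by linarith) (by linarith)
  have hmain : a * Real.log (a / b) ≤ K + Real.exp (-1) := by linarith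
  -- positivity of `a` and `b`
  have ha : 0 < a := ENNReal.toReal_pos hνA.ne' (measure_ne_top ν A)
  have hμA : μ A ≠ 0 := fun h => hνA.ne' (hac h)
  have hb : 0 < b := ENNReal.toReal_pos hμA (measure_ne_top μ A)
  -- solve for `b`
  have hlog : Real.log (a / b) ≤ (K + Real.exp (-1)) / a := by
    rw [le_div_iff₀ ha]; linarith [mul_comm a (Real.log (a / b))]
  have hdiv : a / b ≤ Real.exp ((K + Real.exp (-1)) / a) :=
    (Real.log_le_iff_le_exp (div_pos ha hb)).mp hlog
  rw [div_le_iff₀ hb] at hdiv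
  rw [Real.exp_neg, ← div_eq_mul_inv, div_le_iff₀ (Real.exp_pos _), mul_comm]
  exact hdiv

/-- **Item stmt-QuantumFields-9804 `MarginalTwistOnset.EntropyEventTransfer` holds.** [folklore] -/
theorem marginalTwistOnset_entropyEventTransfer_proof :
    Summit.QuantumFields.YangMills.Theses.MarginalTwistOnset.EntropyEventTransfer := by
  unfold Summit.QuantumFields.YangMills.Theses.MarginalTwistOnset.EntropyEventTransfer
  intro Ω _ μ ν _ _ A hA hKL hνA
  exact measureReal_mul_exp_neg_klDiv_le μ ν hA hKL hνA

end Summit.QuantumFields.YangMills.Theorems
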